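import Mathlib.Algebra.BigOperators.Ring.Finset
import Mathlib.Data.Nat.Choose.Sum
import Mathlib.Analysis.SpecialFunctions.Pow.Real
import HarnessLib

/-!
# An upper-bound `Λ²`-sieve with squarefree divisors indexed by sets of primes

Topic `Literature/NumberTheory/Sieve`, namespace `Literature.NumberTheory.Sieve.Squarefree`.
Everything here is PROVED (definitions with bodies + theorems; no named facts).

This is the combinatorial skeleton of Selberg's upper-bound sieve in the form used by A. Weiss,
*The least prime ideal*, Lemma 3.6 and Thorner–Zaman 2017, Lemma 4.6 (sifting the ideals of a
number field by the prime ideals of small norm), written abstractly: the "primes" are the elements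
of a type `P` with "norms" `N p > 1`, the squarefree divisors are finite sets `S ⊆ P` with norm
`N_S = ∏_{p∈S} N p`, and the admissible divisors form a finite family `D` of sets which is closed
under subsets and contains `∅` (in the application `D = {S : N_S ≤ z}`).  With
`V = Σ_{S∈D} 1/N_S` we use the (non-optimal but sufficient) weights
`y_S = μ(S)/(N_S V)`, `λ_S = N_S Σ_{S ⊆ S' ∈ D} μ(S'∖S) y_{S'}` (`μ(S) = (−1)^{|S|}`):

* `lam_empty` — `λ_∅ = 1`;  `abs_lam_le_one` — `|λ_S| ≤ 1`;
* `sum_lam_div_eq_y` — Möbius inversion on the Boolean lattice: `Σ_{S∈D, T⊆S} λ_S/N_S = y_T`;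
* `quadForm_eq`, `quadForm_le` — `Σ_{S₁,S₂∈D} λ_{S₁}λ_{S₂}/N_{S₁∪S₂} = Σ_{T∈D} φ(T) y_T² ≤ 1/V`
  (`φ(T) = ∏_{p∈T}(N p − 1)`, `N_{S₁∩S₂} = Σ_{T ⊆ S₁∩S₂} φ(T)`);
* `sifted_sum_le` — **the sieve bound**: for finitely many "integers" `n` with weights `w n ≥ 0`
  and prime-divisor sets `dv n ⊆ P`, if `|Σ_{n : S ⊆ dv n} w n − X/N_S| ≤ R` for all `S = S₁ ∪ S₂`,
  `S₁, S₂ ∈ D`, then `Σ_{n : dv n = ∅} w n ≤ X/V + |D|² R`.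

## References

* [Weiss1983] A. Weiss, *The least prime ideal*, J. reine angew. Math. 338 (1983), Lemma 3.6.
* [ThornerZaman2017] J. Thorner, A. Zaman, *An explicit bound for the least prime ideal in the
  Chebotarev density theorem*, Algebra Number Theory 11 (2017), Lemma 4.6.
* H. Halberstam, H.-E. Richert, *Sieve Methods* (1974), Ch. 3 (Selberg's upper bound sieve). [folklore]
-/

noncomputable section

open Finset

namespace Literature.NumberTheory.Sieve.Squarefree

variable {P : Type*} [DecidableEq P]

/-! ### Norms, `μ`, `φ` of squarefree divisors -/

/-- The norm of the squarefree divisor `S`: `N_S = ∏_{p ∈ S} N p`. [folklore] -/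
def nrm (N : P → ℝ) (S : Finset P) : ℝ := ∏ p ∈ S, N p

/-- `μ(S) = (−1)^{|S|}`. [folklore] -/
def mu (S : Finset P) : ℝ := (-1) ^ S.card

/-- `φ(S) = ∏_{p∈S} (N p − 1)`. [folklore] -/
def phi (N : P → ℝ) (S : Finset P) : ℝ := ∏ p ∈ S, (N p - 1)

variable {N : P → ℝ}

omit [DecidableEq P] in
/-- `N_∅ = 1`. [folklore] -/
theorem nrm_empty (N : P → ℝ) : nrm N ∅ = 1 := by simp [nrm]

omit [DecidableEq P] in
/-- `N_S > 0` when all `N p > 1`. [folklore] -/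
theorem nrm_pos (hN : ∀ p, 1 < N p) (S : Finset P) : 0 < nrm N S :=
  prod_pos fun p _ ↦ by linarith [hN p]

omit [DecidableEq P] in
/-- `1 ≤ N_S`. [folklore] -/
theorem one_le_nrm (hN : ∀ p, 1 < N p) (S : Finset P) : 1 ≤ nrm N S := by
  rw [nrm, ← prod_const_one (s := S)]
  exact prod_le_prod (fun _ _ ↦ zero_le_one) fun p _ ↦ (hN p).le

/-- `N_{S ∪ T} N_{S ∩ T} = N_S N_T`. [folklore] -/
theorem nrm_union_mul_nrm_inter (S T : Finset P) : nrm N (S ∪ T) * nrm N (S ∩ T) = nrm N S * nrm N T :=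
  prod_union_inter

/-- For `S ⊆ S'`: `N_{S'} = N_S N_{S'∖S}`. [folklore] -/
theorem nrm_eq_mul_sdiff {S S' : Finset P} (h : S ⊆ S') : nrm N S' = nrm N S * nrm N (S' \ S) := by
  rw [nrm, nrm, nrm, ← prod_union disjoint_sdiff, union_sdiff_of_subset h]

omit [DecidableEq P] in
/-- `μ(S)² = 1`. [folklore] -/
theorem mu_sq (S : Finset P) : mu S ^ 2 = 1 := by
  rw [mu, ← pow_mul, mul_comm, pow_mul, neg_one_sq, one_pow]

omit [DecidableEq P] in
/-- `|μ(S)| = 1`. [folklore] -/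
theorem abs_mu (S : Finset P) : |mu S| = 1 := by
  rw [mu, abs_pow, abs_neg, abs_one, one_pow]

/-- For `S ⊆ S'`: `μ(S'∖S) μ(S') = μ(S)`. [folklore] -/
theorem mu_sdiff_mul_mu {S S' : Finset P} (h : S ⊆ S') : mu (S' \ S) * mu S' = mu S := by
  rw [mu, mu, mu, ← pow_add, card_sdiff_of_subset h]
  have hle : S.card ≤ S'.card := card_le_card h
  rw [show S'.card - S.card + S'.card = 2 * (S'.card - S.card) + S.card by omega, pow_add, pow_mul,
    neg_one_sq, one_pow, one_mul]

omit [DecidableEq P] in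
/-- `0 ≤ φ(S) ≤ N_S` when all `N p > 1`. [folklore] -/
theorem phi_nonneg (hN : ∀ p, 1 < N p) (S : Finset P) : 0 ≤ phi N S :=
  prod_nonneg fun p _ ↦ by linarith [hN p]

omit [DecidableEq P] in
/-- `φ(S) ≤ N_S`. [folklore] -/
theorem phi_le_nrm (hN : ∀ p, 1 < N p) (S : Finset P) : phi N S ≤ nrm N S :=
  prod_le_prod (fun p _ ↦ by linarith [hN p]) fun p _ ↦ by linarith

omit [DecidableEq P] in
/-- `N_S = Σ_{T ⊆ S} φ(T)` (`∏ (1 + (N p − 1)) = ∏ N p`). [folklore] -/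
theorem nrm_eq_sum_phi (S : Finset P) : nrm N S = ∑ T ∈ S.powerset, phi N T := by
  simp only [nrm, phi, ← prod_one_add]
  exact prod_congr rfl fun p _ ↦ by ring

/-! ### The weights -/

/-- `V = Σ_{S ∈ D} 1/N_S`. [folklore] -/
def bigV (N : P → ℝ) (D : Finset (Finset P)) : ℝ := ∑ S ∈ D, 1 / nrm N S

/-- `y_S = μ(S)/(N_S V)` on `D`, `0` off `D`. [folklore] -/
def wy (N : P → ℝ) (D : Finset (Finset P)) (S : Finset P) : ℝ :=
  if S ∈ D then mu S / (nrm N S * bigV N D) else 0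

/-- `λ_S = N_S Σ_{S ⊆ S' ∈ D} μ(S'∖S) y_{S'}`. [folklore] -/
def lam (N : P → ℝ) (D : Finset (Finset P)) (S : Finset P) : ℝ :=
  nrm N S * ∑ S' ∈ D.filter (S ⊆ ·), mu (S' \ S) * wy N D S'

variable {D : Finset (Finset P)}

omit [DecidableEq P] in
/-- `V > 0` as soon as `D ≠ ∅`. [folklore] -/
theorem bigV_pos (hN : ∀ p, 1 < N p) (hD : D.Nonempty) : 0 < bigV N D :=
  sum_pos (fun S _ ↦ one_div_pos.mpr (nrm_pos hN S)) hD

/-- **`λ_∅ = 1`** (`∅ ∈ D`). [folklore] -/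
theorem lam_empty (hN : ∀ p, 1 < N p) (h0 : ∅ ∈ D) : lam N D ∅ = 1 := by
  have hV : 0 < bigV N D := bigV_pos hN ⟨∅, h0⟩
  rw [lam, nrm_empty, one_mul, filter_true_of_mem fun S _ ↦ empty_subset S]
  have e : ∀ S' ∈ D, mu (S' \ ∅) * wy N D S' = (bigV N D)⁻¹ * (1 / nrm N S') := by
    intro S' hS'
    rw [sdiff_empty, wy, if_pos hS', div_eq_mul_inv, ← mul_assoc, ← sq, mu_sq]
    field_simp
  rw [sum_congr rfl e, ← mul_sum, ← bigV, inv_mul_cancel₀ hV.ne']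

/-- **`|λ_S| ≤ 1`**: `λ_S = (μ(S)/V) Σ_{S ⊆ S' ∈ D} 1/N_{S'∖S}` and `S' ↦ S' ∖ S` maps these `S'`
injectively into `D` (`D` is closed under subsets). [folklore] -/
theorem abs_lam_le_one (hN : ∀ p, 1 < N p) (hdown : ∀ S ∈ D, ∀ T ⊆ S, T ∈ D) (h0 : ∅ ∈ D)
    (S : Finset P) : |lam N D S| ≤ 1 := by
  have hV : 0 < bigV N D := bigV_pos hN ⟨∅, h0⟩
  -- rewrite the terms
  have e : ∀ S' ∈ D.filter (S ⊆ ·), nrm N S * (mu (S' \ S) * wy N D S') =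
      mu S * (bigV N D)⁻¹ * (1 / nrm N (S' \ S)) := by
    intro S' hS'
    obtain ⟨hS'D, hsub⟩ := mem_filter.mp hS'
    rw [wy, if_pos hS'D, nrm_eq_mul_sdiff hsub]
    have h1 : 0 < nrm N S := nrm_pos hN S
    have h2 : 0 < nrm N (S' \ S) := nrm_pos hN _
    rw [show nrm N S * (mu (S' \ S) * (mu S' / (nrm N S * nrm N (S' \ S) * bigV N D))) =
      (mu (S' \ S) * mu S') * (nrm N S / (nrm N S * nrm N (S' \ S) * bigV N D)) by ring, mu_sdiff_mul_mu hsub]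
    field_simp
  rw [lam, mul_sum, sum_congr rfl e, ← mul_sum, abs_mul, abs_mul, abs_mu, one_mul, abs_of_pos (inv_pos.mpr hV),
    abs_of_nonneg (sum_nonneg fun S' _ ↦ by have := nrm_pos hN (S' \ S); positivity)]
  rw [inv_mul_le_iff₀ hV, mul_one, bigV]
  -- compare with the sum over the image of `S' ↦ S' \ S`
  calc ∑ S' ∈ D.filter (S ⊆ ·), 1 / nrm N (S' \ S)
      = ∑ U ∈ (D.filter (S ⊆ ·)).image (· \ S), 1 / nrm N U := by
        rw [sum_image]
        intro S₁ h₁ S₂ h₂ heq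
        have hs₁ := (mem_filter.mp h₁).2
        have hs₂ := (mem_filter.mp h₂).2
        have : S₁ \ S ∪ S = S₂ \ S ∪ S := by simpa using congrArg (· ∪ S) heq
        rwa [sdiff_union_of_subset hs₁, sdiff_union_of_subset hs₂] at this
    _ ≤ ∑ U ∈ D, 1 / nrm N U := by
        refine sum_le_sum_of_subset_of_nonneg ?_ fun U _ _ ↦ (one_div_pos.mpr (nrm_pos hN U)).le
        intro U hU
        obtain ⟨S', hS', rfl⟩ := mem_image.mp hU
        exact hdown S' (mem_filter.mp hS').1 _ sdiff_subset

/-- **Möbius inversion**: `Σ_{S ∈ D, T ⊆ S} λ_S/N_S = y_T` (`D` closed under subsets; inner sum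
`Σ_{T ⊆ S ⊆ S'} μ(S'∖S) = [S' = T]`, Mathlib `Finset.sum_powerset_neg_one_pow_card`). [folklore] -/
theorem sum_lam_div_eq_y (hN : ∀ p, 1 < N p) (hdown : ∀ S ∈ D, ∀ T ⊆ S, T ∈ D) (T : Finset P) :
    ∑ S ∈ D.filter (T ⊆ ·), lam N D S / nrm N S = wy N D T := by
  -- `λ_S/N_S = Σ_{S ⊆ S' ∈ D} μ(S'∖S) y_{S'}`
  have e1 : ∀ S ∈ D.filter (T ⊆ ·), lam N D S / nrm N S = ∑ S' ∈ D.filter (S ⊆ ·), mu (S' \ S) * wy N D S' := by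
    intro S _
    rw [lam, mul_div_cancel_left₀ _ (nrm_pos hN S).ne']
  rw [sum_congr rfl e1]
  -- exchange: `Σ_{S ⊇ T} Σ_{S' ⊇ S} = Σ_{S'} y_{S'} Σ_{T ⊆ S ⊆ S'} μ(S'∖S)`
  rw [sum_sigma' (D.filter (T ⊆ ·)) fun S ↦ D.filter (S ⊆ ·)]
  rw [sum_bij' (fun x _ ↦ (⟨x.2, x.1⟩ : Σ _ : Finset P, Finset P)) (fun x _ ↦ ⟨x.2, x.1⟩)
    (t := (D.filter (T ⊆ ·)).sigma fun S' ↦ (S'.powerset).filter (T ⊆ ·))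
    (g := fun x ↦ mu (x.1 \ x.2) * wy N D x.1)]
  rotate_left
  · rintro ⟨S, S'⟩ h
    simp only [mem_sigma, mem_filter, mem_powerset] at h ⊢
    exact ⟨⟨h.2.1, h.1.2.trans h.2.2⟩, h.2.2, h.1.2⟩
  · rintro ⟨S', S⟩ h
    simp only [mem_sigma, mem_filter, mem_powerset] at h ⊢
    exact ⟨⟨hdown S' h.1.1 S h.2.1, h.2.2⟩, h.1.1, h.2.1⟩
  · rintro ⟨S, S'⟩ _; rfl
  · rintro ⟨S', S⟩ _; rfl
  · rintro ⟨S, S'⟩ _; rfl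
  rw [sum_sigma]
  -- inner sums
  have inner : ∀ S' ∈ D.filter (T ⊆ ·),
      ∑ S ∈ (S'.powerset).filter (T ⊆ ·), mu (S' \ S) * wy N D S' = if S' = T then wy N D T else 0 := by
    intro S' hS'
    obtain ⟨hS'D, hTS'⟩ := mem_filter.mp hS'
    rw [← sum_mul]
    -- `Σ_{T ⊆ S ⊆ S'} μ(S' \ S) = Σ_{U ⊆ S' \ T} (−1)^{|U|}`
    have hbij : ∑ S ∈ (S'.powerset).filter (T ⊆ ·), mu (S' \ S) = ∑ U ∈ (S' \ T).powerset, mu U := by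
      refine sum_bij' (fun S _ ↦ S' \ S) (fun U _ ↦ S' \ U) ?_ ?_ ?_ ?_ (fun _ _ ↦ rfl)
      · intro S hS
        obtain ⟨hSS', hTS⟩ := mem_filter.mp hS
        rw [mem_powerset] at hSS' ⊢
        exact sdiff_subset_sdiff subset_rfl hTS
      · intro U hU
        rw [mem_powerset] at hU
        refine mem_filter.mpr ⟨mem_powerset.mpr sdiff_subset, ?_⟩
        intro p hp
        rw [mem_sdiff]
        exact ⟨hTS' hp, fun hpU ↦ (mem_sdiff.mp (hU hpU)).2 hp⟩
      · intro S hS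
        obtain ⟨hSS', -⟩ := mem_filter.mp hS
        rw [mem_powerset] at hSS'
        exact Finset.sdiff_sdiff_eq_self hSS'
      · intro U hU
        rw [mem_powerset] at hU
        exact Finset.sdiff_sdiff_eq_self (hU.trans sdiff_subset)
    rw [hbij]
    have hμ : ∑ U ∈ (S' \ T).powerset, mu U = if S' \ T = ∅ then 1 else 0 := by
      have := (sum_powerset_neg_one_pow_card (x := S' \ T))
      simp only [mu]
      split_ifs at this ⊢ with h
      · exact_mod_cast this
      · exact_mod_cast this
    rw [hμ]
    by_cases h : S' = T
    · subst h; simp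
    · rw [if_neg (fun h0 ↦ h ?_), if_neg h, zero_mul]
      exact (subset_antisymm hTS' (sdiff_eq_empty_iff_subset.mp h0)).symm
  rw [sum_congr rfl inner, sum_ite_eq' (D.filter (T ⊆ ·)) T]
  by_cases hT : T ∈ D
  · rw [if_pos (mem_filter.mpr ⟨hT, subset_rfl⟩)]
  · rw [if_neg (fun h ↦ hT (mem_filter.mp h).1), wy, if_neg hT]

/-- **The quadratic form**: `Σ_{S₁,S₂ ∈ D} λ_{S₁} λ_{S₂}/N_{S₁ ∪ S₂} = Σ_{T ∈ D} φ(T) y_T²`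
(`1/N_{S₁∪S₂} = N_{S₁∩S₂}/(N_{S₁}N_{S₂})`, `N_{S₁∩S₂} = Σ_{T⊆S₁∩S₂} φ(T)`, and `sum_lam_div_eq_y`).
[folklore] -/
theorem quadForm_eq (hN : ∀ p, 1 < N p) (hdown : ∀ S ∈ D, ∀ T ⊆ S, T ∈ D) :
    ∑ S₁ ∈ D, ∑ S₂ ∈ D, lam N D S₁ * lam N D S₂ / nrm N (S₁ ∪ S₂) =
      ∑ T ∈ D, phi N T * wy N D T ^ 2 := by
  set a : Finset P → ℝ := fun S ↦ lam N D S / nrm N S with ha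
  have hy : ∀ T, ∑ S ∈ D, (if T ⊆ S then a S else 0) = wy N D T := by
    intro T; rw [← sum_filter]; exact sum_lam_div_eq_y hN hdown T
  -- each term through `T ⊆ S₁ ∩ S₂`
  have e : ∀ S₁ ∈ D, ∀ S₂ ∈ D, lam N D S₁ * lam N D S₂ / nrm N (S₁ ∪ S₂) =
      ∑ T ∈ D, (if T ⊆ S₁ ∩ S₂ then phi N T else 0) * (a S₁ * a S₂) := by
    intro S₁ h₁ S₂ _
    have hu : 0 < nrm N (S₁ ∪ S₂) := nrm_pos hN _
    have hi : 0 < nrm N (S₁ ∩ S₂) := nrm_pos hN _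
    have h1 : 0 < nrm N S₁ := nrm_pos hN _
    have h2 : 0 < nrm N S₂ := nrm_pos hN _
    have key : lam N D S₁ * lam N D S₂ / nrm N (S₁ ∪ S₂) = nrm N (S₁ ∩ S₂) * (a S₁ * a S₂) := by
      have hui := nrm_union_mul_nrm_inter (N := N) S₁ S₂
      rw [ha]; dsimp only
      field_simp
      linear_combination (lam N D S₁ * lam N D S₂) * hui.symm
    have hfilter : D.filter (· ⊆ S₁ ∩ S₂) = (S₁ ∩ S₂).powerset := by
      ext T
      simp only [mem_filter, mem_powerset]
      exact ⟨fun h ↦ h.2, fun h ↦ ⟨hdown S₁ h₁ T (h.trans inter_subset_left), h⟩⟩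
    rw [key, ← sum_mul, ← sum_filter, hfilter, ← nrm_eq_sum_phi]
  rw [sum_congr rfl fun S₁ h₁ ↦ sum_congr rfl fun S₂ h₂ ↦ e S₁ h₁ S₂ h₂]
  -- exchange the order of summation
  rw [sum_congr rfl fun S₁ _ ↦ sum_comm, sum_comm]
  refine sum_congr rfl fun T _ ↦ ?_
  have hterm : ∀ S₁ S₂ : Finset P, (if T ⊆ S₁ ∩ S₂ then phi N T else 0) * (a S₁ * a S₂) =
      phi N T * ((if T ⊆ S₁ then a S₁ else 0) * (if T ⊆ S₂ then a S₂ else 0)) := by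
    intro S₁ S₂
    by_cases h1 : T ⊆ S₁ <;> by_cases h2 : T ⊆ S₂ <;>
      simp [h1, h2, subset_inter_iff]
  simp_rw [hterm]
  rw [← hy T, sq, sum_mul_sum, mul_sum]
  refine sum_congr rfl fun S₁ _ ↦ ?_
  rw [mul_sum]

/-- **`Σ_{T∈D} φ(T) y_T² ≤ 1/V`** (`φ(T) ≤ N_T`, `y_T = μ(T)/(N_T V)`). [folklore] -/
theorem quadForm_le (hN : ∀ p, 1 < N p) (h0 : ∅ ∈ D) :
    ∑ T ∈ D, phi N T * wy N D T ^ 2 ≤ 1 / bigV N D := by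
  have hV : 0 < bigV N D := bigV_pos hN ⟨∅, h0⟩
  calc ∑ T ∈ D, phi N T * wy N D T ^ 2 ≤ ∑ T ∈ D, (1 / nrm N T) * (bigV N D)⁻¹ ^ 2 := by
        refine sum_le_sum fun T hT ↦ ?_
        have hT0 : 0 < nrm N T := nrm_pos hN T
        rw [wy, if_pos hT, div_pow, mu_sq, mul_pow]
        calc phi N T * (1 / (nrm N T ^ 2 * bigV N D ^ 2)) ≤ nrm N T * (1 / (nrm N T ^ 2 * bigV N D ^ 2)) :=
              mul_le_mul_of_nonneg_right (phi_le_nrm hN T) (by positivity)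
          _ = 1 / nrm N T * (bigV N D)⁻¹ ^ 2 := by field_simp
    _ = 1 / bigV N D := by
        rw [← sum_mul, ← bigV]; field_simp

/-! ### The sieve bound -/

/-- **The upper-bound sieve with squarefree divisors**: let `A` be a finite set of "integers" `n`
with weights `w n ≥ 0` and sets `dv n ⊆ P` of prime divisors, and suppose
`|Σ_{n ∈ A : S₁ ∪ S₂ ⊆ dv n} w n − X/N_{S₁∪S₂}| ≤ R` for all `S₁, S₂ ∈ D` (`X ≥ 0`). Then
`Σ_{n ∈ A : dv n = ∅} w n ≤ X/V + |D|² R`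
(`𝟙[dv n = ∅] ≤ (Σ_{S∈D, S⊆dv n} λ_S)²`, expand, `quadForm_eq`, `quadForm_le`, `|λ_S| ≤ 1`).
[cite: Weiss1983, Lemma 3.6] -/
theorem sifted_sum_le (hN : ∀ p, 1 < N p) (hdown : ∀ S ∈ D, ∀ T ⊆ S, T ∈ D) (h0 : ∅ ∈ D)
    {ι : Type*} (A : Finset ι) (w : ι → ℝ) (hw : ∀ n, 0 ≤ w n) (dv : ι → Finset P) {X R : ℝ}
    (hX : 0 ≤ X)
    (hR : ∀ S₁ ∈ D, ∀ S₂ ∈ D,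
      |∑ n ∈ A.filter (fun n ↦ S₁ ∪ S₂ ⊆ dv n), w n - X / nrm N (S₁ ∪ S₂)| ≤ R) :
    ∑ n ∈ A.filter (fun n ↦ dv n = ∅), w n ≤ X / bigV N D + (D.card : ℝ) ^ 2 * R := by
  have hV : 0 < bigV N D := bigV_pos hN ⟨∅, h0⟩
  set c : ι → Finset P → ℝ := fun n S ↦ if S ⊆ dv n then lam N D S else 0 with hc
  -- (1) `𝟙[dv n = ∅] w n ≤ w n (Σ_S c n S)²`
  have h1 : ∑ n ∈ A.filter (fun n ↦ dv n = ∅), w n ≤ ∑ n ∈ A, w n * (∑ S ∈ D, c n S) ^ 2 := by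
    rw [sum_filter]
    refine sum_le_sum fun n _ ↦ ?_
    split_ifs with h
    · have : ∑ S ∈ D, c n S = 1 := by
        rw [hc]; dsimp only
        rw [h]
        rw [sum_eq_single_of_mem ∅ h0 fun S _ hS ↦ if_neg fun hsub ↦ hS (subset_empty.mp hsub),
          if_pos (subset_refl _), lam_empty hN h0]
      rw [this, one_pow, mul_one]
    · exact mul_nonneg (hw n) (sq_nonneg _)
  -- (2) expand the square and exchange
  have h2 : ∑ n ∈ A, w n * (∑ S ∈ D, c n S) ^ 2 =
      ∑ S₁ ∈ D, ∑ S₂ ∈ D, lam N D S₁ * lam N D S₂ * ∑ n ∈ A.filter (fun n ↦ S₁ ∪ S₂ ⊆ dv n), w n := by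
    have hsq : ∀ n, w n * (∑ S ∈ D, c n S) ^ 2 =
        ∑ S₁ ∈ D, ∑ S₂ ∈ D, lam N D S₁ * lam N D S₂ * (if S₁ ∪ S₂ ⊆ dv n then w n else 0) := by
      intro n
      rw [sq, sum_mul_sum, mul_sum]
      refine sum_congr rfl fun S₁ _ ↦ ?_
      rw [mul_sum]
      refine sum_congr rfl fun S₂ _ ↦ ?_
      rw [hc]; dsimp only
      by_cases ha : S₁ ⊆ dv n <;> by_cases hb : S₂ ⊆ dv n <;> simp [ha, hb, union_subset_iff]
      ring
    simp_rw [hsq]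
    rw [sum_comm]
    refine sum_congr rfl fun S₁ _ ↦ ?_
    rw [sum_comm]
    refine sum_congr rfl fun S₂ _ ↦ ?_
    rw [← mul_sum, sum_filter]
  -- (3) main term and error
  have h3 : ∑ S₁ ∈ D, ∑ S₂ ∈ D, lam N D S₁ * lam N D S₂ * ∑ n ∈ A.filter (fun n ↦ S₁ ∪ S₂ ⊆ dv n), w n ≤
      X * ∑ S₁ ∈ D, ∑ S₂ ∈ D, lam N D S₁ * lam N D S₂ / nrm N (S₁ ∪ S₂) + (D.card : ℝ) ^ 2 * R := by
    have hsplit : ∀ S₁ ∈ D, ∀ S₂ ∈ D,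
        lam N D S₁ * lam N D S₂ * ∑ n ∈ A.filter (fun n ↦ S₁ ∪ S₂ ⊆ dv n), w n ≤
          X * (lam N D S₁ * lam N D S₂ / nrm N (S₁ ∪ S₂)) + R := by
      intro S₁ h₁ S₂ h₂
      have hE := hR S₁ h₁ S₂ h₂
      have hl : |lam N D S₁ * lam N D S₂| ≤ 1 := by
        rw [abs_mul]
        exact mul_le_one₀ (abs_lam_le_one hN hdown h0 S₁) (abs_nonneg _) (abs_lam_le_one hN hdown h0 S₂)
      have key : lam N D S₁ * lam N D S₂ * ∑ n ∈ A.filter (fun n ↦ S₁ ∪ S₂ ⊆ dv n), w n =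
          X * (lam N D S₁ * lam N D S₂ / nrm N (S₁ ∪ S₂)) +
            lam N D S₁ * lam N D S₂ * (∑ n ∈ A.filter (fun n ↦ S₁ ∪ S₂ ⊆ dv n), w n - X / nrm N (S₁ ∪ S₂)) := by
        ring
      rw [key]
      set E : ℝ := ∑ n ∈ A.filter (fun n ↦ S₁ ∪ S₂ ⊆ dv n), w n - X / nrm N (S₁ ∪ S₂) with hEdef
      have hcalc : lam N D S₁ * lam N D S₂ * E ≤ R :=
        calc lam N D S₁ * lam N D S₂ * E ≤ |lam N D S₁ * lam N D S₂ * E| := le_abs_self _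
          _ = |lam N D S₁ * lam N D S₂| * |E| := abs_mul _ _
          _ ≤ 1 * R := mul_le_mul hl hE (abs_nonneg _) zero_le_one
          _ = R := one_mul R
      linarith
    calc ∑ S₁ ∈ D, ∑ S₂ ∈ D, lam N D S₁ * lam N D S₂ * ∑ n ∈ A.filter (fun n ↦ S₁ ∪ S₂ ⊆ dv n), w n
        ≤ ∑ S₁ ∈ D, ∑ S₂ ∈ D, (X * (lam N D S₁ * lam N D S₂ / nrm N (S₁ ∪ S₂)) + R) :=
          sum_le_sum fun S₁ h₁ ↦ sum_le_sum fun S₂ h₂ ↦ hsplit S₁ h₁ S₂ h₂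
      _ = X * ∑ S₁ ∈ D, ∑ S₂ ∈ D, lam N D S₁ * lam N D S₂ / nrm N (S₁ ∪ S₂) + (D.card : ℝ) ^ 2 * R := by
          simp only [sum_add_distrib, sum_const, nsmul_eq_mul, ← mul_sum]
          ring
  -- (4) assemble
  refine h1.trans ?_
  rw [h2]
  refine h3.trans ?_
  rw [quadForm_eq hN hdown]
  have h4 := mul_le_mul_of_nonneg_left (quadForm_le (N := N) (D := D) hN h0) hX
  rw [mul_one_div] at h4
  linarith

end Literature.NumberTheory.Sieve.Squarefree

end
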